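import Summits.RiemannHypothesis.RiemannHypothesis.Theorems.UniversalFactorLehmerTails
import Mathlib.MeasureTheory.Integral.IntegralEqImproper
import Mathlib.MeasureTheory.Integral.ExpDecay

/-!
# RiemannHypothesis / UniversalFactor — cell decomposition of the forward one-sided average

Route `RiemannHypothesis/UniversalFactor`, computation crux `MediumKernelNoGo`
(stmt-RiemannHypothesis-2577), line *one-sided-average-sign-test*, stub `stub_highSideQ`.

For the dip certificate at `x₀ = 2t₀` the forward Laplace(`a`) average
`Q = ∫₀^∞ H_0(2t₀ + y) e^{−ay} dy` (`H_0 = deBruijnH 0`, real on the real axis) is evaluated by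
certified quadrature on `Cy` cells of half-width `ρ` in the variable `t = t₀ + y/2` plus a tail from
`Y = 4ρ·Cy`.  This file is the (estimate-free) bookkeeping identity

`Re Q = 2 · ∑_{c < Cy} ∫_{t₀ + 2cρ}^{t₀ + 2(c+1)ρ} Re H_0(2t) e^{−2a(t − t₀)} dt`
`       + Re ∫_{y > Y} H_0(2t₀ + y) e^{−ay} dy`:

* `UniversalFactor.highSideQ_integrableOn` — `y ↦ H_0(2t₀ + y) e^{−ay}` is integrable on every
  half-line `(c, ∞)` (`‖H_0‖ ≤ ¼` on `ℝ`, `UniversalFactor.norm_deBruijnH_zero_le_quarter`);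
* `UniversalFactor.stub_highSideQ` — split `(0, ∞) = (0, Y] ∪ (Y, ∞)`, substitute `y = 2(t − t₀)`,
  cut `[t₀, t₀ + 2ρCy]` into the `Cy` adjacent cells, take real parts.

References: E. C. Titchmarsh, *The Theory of the Riemann Zeta-Function* (1986), §10.1 (the kernel);
standard calculus otherwise.
-/

set_option linter.dupNamespace false

noncomputable section

namespace Summit.RiemannHypothesis.RiemannHypothesis.Theorems

open Set MeasureTheory
open Literature.NumberTheory.LFunctions

/-- For real `x`, `H_0(x)` is the real number `Re H_0(x)` (`H_0` is real on the real axis).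
[folklore] -/
theorem UniversalFactor.highSideQ_eq_ofReal_re (x : ℝ) :
    deBruijnH 0 x = (((deBruijnH 0 x).re : ℝ) : ℂ) := by
  have him : (deBruijnH 0 x).im = 0 := by
    rw [← deBruijnHDiv_one']
    exact deBruijnHDiv_ofReal_im _ x
  exact Complex.ext (by rw [Complex.ofReal_re]) (by rw [Complex.ofReal_im, him])

/-- `y ↦ H_0(2t₀ + y) e^{−ay}` is continuous. [folklore] -/
theorem UniversalFactor.highSideQ_continuous (t₀ a : ℝ) :
    Continuous fun y : ℝ => deBruijnH 0 (((2 * t₀ : ℝ) : ℂ) + y) * (Real.exp (-(a * y)) : ℂ) := by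
  have h1 : Continuous fun y : ℝ => deBruijnH 0 (((2 * t₀ : ℝ) : ℂ) + y) :=
    continuous_deBruijnH_zero.comp (by fun_prop)
  have h2 : Continuous fun y : ℝ => ((Real.exp (-(a * y)) : ℝ) : ℂ) := by fun_prop
  exact h1.mul h2

/-- `y ↦ H_0(2t₀ + y) e^{−ay}` is integrable on every half-line `(c, ∞)` for `a > 0`
(`‖H_0‖ ≤ ¼` on the real axis). [folklore] -/
theorem UniversalFactor.highSideQ_integrableOn {a : ℝ} (ha : 0 < a) (t₀ c : ℝ) :
    IntegrableOn (fun y : ℝ => deBruijnH 0 (((2 * t₀ : ℝ) : ℂ) + y) * (Real.exp (-(a * y)) : ℂ))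
      (Ioi c) := by
  refine Integrable.mono' ((exp_neg_integrableOn_Ioi c ha).const_mul (1 / 4))
    (UniversalFactor.highSideQ_continuous t₀ a).aestronglyMeasurable
    (Filter.Eventually.of_forall fun y => ?_)
  rw [norm_mul, Complex.norm_real, Real.norm_of_nonneg (Real.exp_pos _).le, neg_mul]
  have hq := UniversalFactor.norm_deBruijnH_zero_le_quarter (2 * t₀ + y)
  rw [show (((2 * t₀ + y : ℝ)) : ℂ) = ((2 * t₀ : ℝ) : ℂ) + y by push_cast; ring] at hq
  exact mul_le_mul_of_nonneg_right hq (Real.exp_pos _).le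

/-- `t ↦ Re H_0(2t) e^{−2a(t − t₀)}` is continuous. [folklore] -/
theorem UniversalFactor.highSideQ_continuous_cell (t₀ a : ℝ) :
    Continuous fun t : ℝ => (deBruijnH 0 ((2 * t : ℝ) : ℂ)).re * Real.exp (-(2 * a) * (t - t₀)) :=
  (Complex.continuous_re.comp (continuous_deBruijnH_zero.comp (by fun_prop))).mul (by fun_prop)

/-- The substituted integrand: at `y = 2(t − t₀)`,
`H_0(2t₀ + y) e^{−ay} = Re H_0(2t) · e^{−2a(t − t₀)}` (a real number). [folklore] -/
theorem UniversalFactor.highSideQ_integrand (t₀ a t : ℝ) :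
    deBruijnH 0 (((2 * t₀ : ℝ) : ℂ) + ((2 * t - 2 * t₀ : ℝ) : ℂ)) *
        (Real.exp (-(a * (2 * t - 2 * t₀))) : ℂ) =
      (((deBruijnH 0 ((2 * t : ℝ) : ℂ)).re * Real.exp (-(2 * a) * (t - t₀)) : ℝ) : ℂ) := by
  have h1 : ((2 * t₀ : ℝ) : ℂ) + ((2 * t - 2 * t₀ : ℝ) : ℂ) = ((2 * t : ℝ) : ℂ) := by
    push_cast; ring
  have h2 : Real.exp (-(a * (2 * t - 2 * t₀))) = Real.exp (-(2 * a) * (t - t₀)) := by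
    congr 1; ring
  rw [h1, h2, Complex.ofReal_mul ((deBruijnH 0 ((2 * t : ℝ) : ℂ)).re),
    ← UniversalFactor.highSideQ_eq_ofReal_re]

/-- The cells `[t₀ + (2c+1)ρ − ρ, t₀ + (2c+1)ρ + ρ]`, `c < Cy`, tile `[t₀, t₀ + 2ρ·Cy]`.
[folklore] -/
theorem UniversalFactor.highSideQ_sum_cells {g : ℝ → ℝ} (hg : Continuous g) (t₀ ρ : ℝ) (Cy : ℕ) :
    ∑ c ∈ Finset.range Cy, ∫ t in (t₀ + (2 * c + 1) * ρ - ρ)..(t₀ + (2 * c + 1) * ρ + ρ), g t =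
      ∫ t in t₀..(t₀ + 2 * ρ * Cy), g t := by
  have hadj := intervalIntegral.sum_integral_adjacent_intervals (μ := volume) (f := g)
    (a := fun k : ℕ => t₀ + 2 * ρ * k) (n := Cy) (fun k _ => hg.intervalIntegrable _ _)
  simp only [Nat.cast_zero, mul_zero, add_zero] at hadj
  rw [← hadj]
  refine Finset.sum_congr rfl fun c _ => ?_
  have e1 : t₀ + (2 * (c : ℝ) + 1) * ρ - ρ = t₀ + 2 * ρ * c := by ring
  have e2 : t₀ + (2 * (c : ℝ) + 1) * ρ + ρ = t₀ + 2 * ρ * ((c + 1 : ℕ) : ℝ) := by push_cast; ring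
  rw [e1, e2]

/-- **Cell decomposition of the forward average.** For `a > 0`, `ρ > 0` and `Cy` cells:
`Re ∫₀^∞ H_0(2t₀ + y) e^{−ay} dy
  = 2 ∑_{c<Cy} ∫_{cell c} Re H_0(2t) e^{−2a(t−t₀)} dt + Re ∫_{y>4ρCy} H_0(2t₀ + y) e^{−ay} dy`,
via `(0,∞) = (0, 4ρCy] ∪ (4ρCy, ∞)` and the substitution `y = 2(t − t₀)`. [folklore] -/
theorem UniversalFactor.stub_highSideQ :
    ∀ (t₀ a ρ : ℝ) (Cy : ℕ), 0 < a → 0 < ρ →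
      (∫ y in Set.Ioi (0:ℝ), deBruijnH 0 (((2 * t₀ : ℝ) : ℂ) + y) * (Real.exp (-(a * y)) : ℂ)).re =
        2 * (∑ c ∈ Finset.range Cy, ∫ t in (t₀ + (2 * c + 1) * ρ - ρ)..(t₀ + (2 * c + 1) * ρ + ρ),
          (deBruijnH 0 ((2 * t : ℝ) : ℂ)).re * Real.exp (-(2 * a) * (t - t₀))) +
        (∫ y in Set.Ioi (4 * ρ * Cy), deBruijnH 0 (((2 * t₀ : ℝ) : ℂ) + y) *
          (Real.exp (-(a * y)) : ℂ)).re := by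
  intro t₀ a ρ Cy ha _hρ
  have hint := UniversalFactor.highSideQ_integrableOn ha t₀
  rw [← intervalIntegral.integral_interval_add_Ioi (hint 0) (hint (4 * ρ * Cy)), Complex.add_re]
  congr 1
  have hsub : (∫ y in (0:ℝ)..(4 * ρ * Cy),
      deBruijnH 0 (((2 * t₀ : ℝ) : ℂ) + y) * (Real.exp (-(a * y)) : ℂ)) =
      (2:ℝ) • ∫ t in t₀..(t₀ + 2 * ρ * Cy),
        deBruijnH 0 (((2 * t₀ : ℝ) : ℂ) + ((2 * t - 2 * t₀ : ℝ) : ℂ)) *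
          (Real.exp (-(a * (2 * t - 2 * t₀))) : ℂ) := by
    rw [intervalIntegral.smul_integral_comp_mul_sub
      (fun y : ℝ => deBruijnH 0 (((2 * t₀ : ℝ) : ℂ) + y) * (Real.exp (-(a * y)) : ℂ)) 2 (2 * t₀)]
    congr 1 <;> ring
  rw [hsub]
  simp_rw [UniversalFactor.highSideQ_integrand t₀ a]
  rw [intervalIntegral.integral_ofReal, Complex.smul_re, Complex.ofReal_re, smul_eq_mul,
    UniversalFactor.highSideQ_sum_cells (UniversalFactor.highSideQ_continuous_cell t₀ a) t₀ ρ Cy]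

end Summit.RiemannHypothesis.RiemannHypothesis.Theorems
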